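import Summits.CriticalPhenomena.PercolationContinuityZ3.Theorems.PercNearOneGluingNoHeavyRsw3SlabSpanningClusters
import HarnessLib

/-!
# The cube instance of Aizenman's slab dichotomy at `p_c(ℤ³)`: at every scale, the cube is BLOCKED or the
# `1 : 3 : 3` slab-box carries TWO spanning clusters

builds on p205010 (kernel theorem, internal audit signed; external expert review pending)

RSW3 lane (LANE 3), seat `prim-rsw3-p2` (gen 3). Helper file for the crux `stmt-CriticalPhenomena-4575` (`--supports`).
No definitions, no named facts, no sorries.  Notation as in `…Rsw3SlabBlocks.lean`; `P = P_{p_c(ℤ³)}`,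
`δ₂ = KestenZhang.critTwoArmsDelta 2`.

Taking the cell to be the CUBE (`w = n`) and the block to be the `1 : 3 : 3` slab-box (`M = 3n + 2`) in the slab dichotomy
`Rsw3.real_compl_slabCross_add_twoSpan_gt_criticalProbI` (Aizenman's criterion (ii) at `p_c`, contradiction with
`θ(p_c) = 0`), and passing to the lane's crossing event `Crossing.boxCross (cubeShape n) 0` (whose complement is the event of
the route item `PercAnnulusCrossing.CubeBlockingSeed`, stmt-CriticalPhenomena-1141, `Crossing.cubeBlockingSeed_iff`):

* `real_compl_boxCross_cube_add_twoSpan_gt_criticalProbI` — for every `n ≥ 1`: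
  `P((boxCross (cubeShape n) 0)ᶜ) + P(TwoSpan_n {0..n}×{0..3n+2}²) > δ₂^{49}`;
* `cubeBlocking_or_twoSpan_criticalProbI` — hence at every scale `n ≥ 1`, EITHER the cube `{0..n}³` is not crossed with
  probability `> δ₂^{49}/2` (the `CubeBlockingSeed` alternative, hyperscaling side, false above six dimensions), OR the
  slab-box `{0..n}×{0..3n+2}²` of aspect `≈ 1/3` contains two spanning clusters with probability `> δ₂^{49}/2`
  (non-uniqueness at SMALL aspect, where Theorem 2 — `aizenman_twoSpanningClusters_criticalProbI`, aspect `≤ 1/K` —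
  does not reach).  Which alternative holds is open (numerically both, non-rigorous lane census).

References: M. Aizenman, Nucl. Phys. B 485 (1997) 551–582, §2 (criterion (ii)) and §5 [Aizenman1997].
-/

noncomputable section

namespace Summit.CriticalPhenomena.PercolationContinuityZ3.Theorems.Rsw3

open MeasureTheory Literature.Probability.LatticeModels Literature.Probability.Percolation
open Literature.Probability.Percolation.KestenZhang
open Summit.CriticalPhenomena.PercolationContinuityZ3.Theorems.Crossing

/-- **Cube blocking plus `1:3:3` two-spanning exceeds `δ₂^{49}` at `p_c(ℤ³)`, every scale**: for `n ≥ 1`,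
`P_{p_c}((boxCross (cubeShape n) 0)ᶜ) + P_{p_c}({0..n}×{0..3n+2}² contains two spanning open paths not joined inside it)
> δ₂^{49}`.  The slab dichotomy with cell `= cube` (`w = n`) and block side `M = 3n + 2`; `boxCross ⊆ Cross_n` almost
surely (`real_boxCross_le_real_slabCross`).  builds on p205010 (kernel theorem, internal audit signed; external expert
review pending). [cite: Aizenman1997, §2 (criterion (ii) at p_c)] -/
theorem real_compl_boxCross_cube_add_twoSpan_gt_criticalProbI {n : ℕ} (hn : 1 ≤ n) :
    critTwoArmsDelta 2 ^ 49 <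
      (bondPercolation (zdGraph 3) (criticalProbI 3)).real (boxCross (cubeShape n) 0)ᶜ +
        (bondPercolation (zdGraph 3) (criticalProbI 3)).real
          {ω : BondConfig (Site 3) | ∃ x ∈ Finset.Icc (0 : Site 3) ![(n : ℤ), ((3 * n + 2 : ℕ) : ℤ), ((3 * n + 2 : ℕ) : ℤ)],
            ∃ x' ∈ Finset.Icc (0 : Site 3) ![(n : ℤ), ((3 * n + 2 : ℕ) : ℤ), ((3 * n + 2 : ℕ) : ℤ)],
            ∃ y ∈ Finset.Icc (0 : Site 3) ![(n : ℤ), ((3 * n + 2 : ℕ) : ℤ), ((3 * n + 2 : ℕ) : ℤ)],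
            ∃ y' ∈ Finset.Icc (0 : Site 3) ![(n : ℤ), ((3 * n + 2 : ℕ) : ℤ), ((3 * n + 2 : ℕ) : ℤ)],
            x 0 = 0 ∧ x' 0 = 0 ∧ y 0 = (n : ℤ) ∧ y' 0 = (n : ℤ) ∧
            ω ∈ inConn ↑(Finset.Icc (0 : Site 3) ![(n : ℤ), ((3 * n + 2 : ℕ) : ℤ), ((3 * n + 2 : ℕ) : ℤ)]) x y ∧
            ω ∈ inConn ↑(Finset.Icc (0 : Site 3) ![(n : ℤ), ((3 * n + 2 : ℕ) : ℤ), ((3 * n + 2 : ℕ) : ℤ)]) x' y' ∧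
            ω ∉ inConn ↑(Finset.Icc (0 : Site 3) ![(n : ℤ), ((3 * n + 2 : ℕ) : ℤ), ((3 * n + 2 : ℕ) : ℤ)]) x x'} := by
  have hdich := real_compl_slabCross_add_twoSpan_gt_criticalProbI (n := n) (w := n) (M := 3 * n + 2) hn le_rfl (by omega)
  -- the complement of the `inConn` spanning event of the cube is a.s. contained in the complement of `boxCross`
  have hle : (bondPercolation (zdGraph 3) (criticalProbI 3)).real
      {ω : BondConfig (Site 3) | ∃ x ∈ Finset.Icc (0 : Site 3) ![(n : ℤ), n, n], ∃ y ∈ Finset.Icc (0 : Site 3) ![(n : ℤ), n, n],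
        x 0 = 0 ∧ y 0 = (n : ℤ) ∧ ω ∈ inConn ↑(Finset.Icc (0 : Site 3) ![(n : ℤ), n, n]) x y}ᶜ ≤
      (bondPercolation (zdGraph 3) (criticalProbI 3)).real (boxCross (cubeShape n) 0)ᶜ := by
    refine DCT16.real_mono_of_forall_subset_edgeSet (zdGraph 3) _ fun ω hω hnot hbox => hnot ?_
    obtain ⟨x, hx, y, hy, hx0, hyL, hconn⟩ := hbox
    refine ⟨x, hx, y, hy, hx0, ?_, mem_inConn_of_mem_openConnIn hω hx hconn⟩
    simpa [cubeShape] using hyL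
  linarith

/-- **The cube dichotomy at `p_c(ℤ³)`**: for every `n ≥ 1`, either the cube `{0..n}³` is NOT crossed (direction `0`) with
probability `> δ₂^{49}/2` — the alternative of the route item `CubeBlockingSeed` (stmt-CriticalPhenomena-1141) at scale
`n` — or the `1:3:3` slab-box `{0..n}×{0..3n+2}²` contains two spanning clusters with probability `> δ₂^{49}/2`.
builds on p205010 (kernel theorem, internal audit signed; external expert review pending). [cite: Aizenman1997, §2 (criterion (ii) at p_c)] -/
theorem cubeBlocking_or_twoSpan_criticalProbI {n : ℕ} (hn : 1 ≤ n) :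
    critTwoArmsDelta 2 ^ 49 / 2 < (bondPercolation (zdGraph 3) (criticalProbI 3)).real (boxCross (cubeShape n) 0)ᶜ ∨
      critTwoArmsDelta 2 ^ 49 / 2 <
        (bondPercolation (zdGraph 3) (criticalProbI 3)).real
          {ω : BondConfig (Site 3) | ∃ x ∈ Finset.Icc (0 : Site 3) ![(n : ℤ), ((3 * n + 2 : ℕ) : ℤ), ((3 * n + 2 : ℕ) : ℤ)],
            ∃ x' ∈ Finset.Icc (0 : Site 3) ![(n : ℤ), ((3 * n + 2 : ℕ) : ℤ), ((3 * n + 2 : ℕ) : ℤ)],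
            ∃ y ∈ Finset.Icc (0 : Site 3) ![(n : ℤ), ((3 * n + 2 : ℕ) : ℤ), ((3 * n + 2 : ℕ) : ℤ)],
            ∃ y' ∈ Finset.Icc (0 : Site 3) ![(n : ℤ), ((3 * n + 2 : ℕ) : ℤ), ((3 * n + 2 : ℕ) : ℤ)],
            x 0 = 0 ∧ x' 0 = 0 ∧ y 0 = (n : ℤ) ∧ y' 0 = (n : ℤ) ∧
            ω ∈ inConn ↑(Finset.Icc (0 : Site 3) ![(n : ℤ), ((3 * n + 2 : ℕ) : ℤ), ((3 * n + 2 : ℕ) : ℤ)]) x y ∧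
            ω ∈ inConn ↑(Finset.Icc (0 : Site 3) ![(n : ℤ), ((3 * n + 2 : ℕ) : ℤ), ((3 * n + 2 : ℕ) : ℤ)]) x' y' ∧
            ω ∉ inConn ↑(Finset.Icc (0 : Site 3) ![(n : ℤ), ((3 * n + 2 : ℕ) : ℤ), ((3 * n + 2 : ℕ) : ℤ)]) x x'} := by
  by_contra h
  push Not at h
  have := real_compl_boxCross_cube_add_twoSpan_gt_criticalProbI hn
  linarith [h.1, h.2]

end Summit.CriticalPhenomena.PercolationContinuityZ3.Theorems.Rsw3

end
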